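import Literature.NumberTheory.Sieve.FordMaynardFragmentation

/-!
# Route `FordMaynardNoSieveConst0164`, crux `NegWitness0164` (stmt-Parity-19102), line `birth`,
# stub `stub_tweakNeg0164`: block weights of unfragmented and of small blocks (Lemma 5.5)

Sixth helper file toward the certificate stub (K. Ford, J. Maynard, *On the theory of prime producing
sieves*, arXiv:2407.14368, Lemma 5.5 and §6.1, remarks after (6.3): "`𝓛_{1-γ}(u_j) = 𝟙(k_j = 1)` when
`ξ_j < 1 - γ` and `𝓛_{1-γ}(ξ_j) = 0` when `ξ_j ≥ 1 - γ`").  The three values of the block weight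
`blockWeight γ k v = 𝓛_{1-γ}(v)/(k! v₁⋯v_k)` of the fragmentation operator that sort the terms of (6.3) at a
vector `(b, α)` of the certificate (small components `b_i` stay unfragmented with weight `1/b_i`; a large
component `α ≥ 1 - γ` must be fragmented; a small component is never fragmented):

* `blockWeight_one_eq` — one piece `0 ≤ v₀ < 1 - γ`: weight `1/v₀`;
* `blockWeight_one_eq_zero_of_le` — one piece `v₀ ≥ 1 - γ`: weight `0`;
* `blockWeight_eq_zero_of_sum_lt` — `k ≥ 2` nonnegative pieces with total `< 1 - γ`: weight `0`.

Def-free; the inputs of the `m = 2, 3` analogues of `fragOp_one_eq_sum_sliceIntegral` (repair-census item R1).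
References: [FordMaynard2024PrimeSieves] arXiv:2407.14368, Lemma 5.5, §6.1.
-/

noncomputable section

open Finset
open Literature.Combinatorics.Enumerative
open Literature.NumberTheory.Sieve Literature.NumberTheory.Sieve.FordMaynard

namespace Summit.Parity.GeneralizedHardyLittlewood.FordMaynardNoSieveConst0164NegWitness0164

/-- **An unfragmented small component has weight `1/v₀`**: for one piece `0 ≤ v₀ < 1 - γ`,
`blockWeight γ 1 v = 𝓛_{1-γ}((v₀))/(1!·v₀) = 1/v₀` (Lemma 5.5 (b)).
[cite: FordMaynard2024PrimeSieves, Lemma 5.5 (b) and §6.1 (remarks after (6.3))] -/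
theorem blockWeight_one_eq {γ : ℝ} (v : Fin 1 → ℝ) (h0 : 0 ≤ v 0) (h1 : v 0 < 1 - γ) :
    blockWeight γ 1 v = 1 / v 0 := by
  unfold blockWeight
  rw [linnikFn_eq_of_sum_lt (1 - γ) v Finset.univ_nonempty (fun k _ => by rw [Subsingleton.elim k 0]; exact h0)
      (by simpa using h1), if_pos (by simp), Nat.factorial_one, Fin.prod_univ_one]
  simp

/-- **A single large piece has weight `0`**: for one piece `v₀ ≥ max(0, 1 - γ)`, `blockWeight γ 1 v = 0`
(Lemma 5.5 (a)) — a component `≥ 1 - γ` must be fragmented.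
[cite: FordMaynard2024PrimeSieves, Lemma 5.5 (a) and §6.1] -/
theorem blockWeight_one_eq_zero_of_le {γ : ℝ} (v : Fin 1 → ℝ) (h0 : 0 ≤ v 0) (h1 : 1 - γ ≤ v 0) :
    blockWeight γ 1 v = 0 := by
  unfold blockWeight
  rw [linnikFn_eq_zero_of_mem (1 - γ) v (Finset.mem_univ 0) h1
      (fun k _ => by rw [Subsingleton.elim k 0]; exact h0), zero_div]

/-- **A small component is never fragmented**: for `k ≥ 2` nonnegative pieces with total `< 1 - γ`,
`blockWeight γ k v = 0` (Lemma 5.5 (b): `𝓛_{1-γ}(v) = 𝟙(k = 1)`).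
[cite: FordMaynard2024PrimeSieves, Lemma 5.5 (b) and §6.1 (remarks after (6.3))] -/
theorem blockWeight_eq_zero_of_sum_lt {γ : ℝ} {k : ℕ} (hk : 2 ≤ k) (v : Fin k → ℝ) (h0 : ∀ i, 0 ≤ v i)
    (hs : ∑ i, v i < 1 - γ) : blockWeight γ k v = 0 := by
  have hne : (Finset.univ : Finset (Fin k)).Nonempty :=
    Finset.univ_nonempty_iff.2 ⟨⟨0, by omega⟩⟩
  unfold blockWeight
  rw [linnikFn_eq_of_sum_lt (1 - γ) v hne (fun i _ => h0 i) hs, if_neg, zero_div]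
  rw [Finset.card_univ, Fintype.card_fin]
  omega

end Summit.Parity.GeneralizedHardyLittlewood.FordMaynardNoSieveConst0164NegWitness0164

end
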